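import Summits.QuantumAdvantage.QuantumAdvantage.Theorems.CubicForrelationNearExactIsExactKtThreeForm
import Summits.QuantumAdvantage.QuantumAdvantage.Theorems.CubicForrelationNearExactIsExactCubicForm
import Summits.QuantumAdvantage.QuantumAdvantage.Theorems.CubicForrelationNearExactIsExactTwelveOddWeightLight
import Summits.QuantumAdvantage.QuantumAdvantage.Theorems.CubicForrelationNearExactIsExactCubicFormSymplectic
import Summits.QuantumAdvantage.QuantumAdvantage.Theorems.CubicForrelationNearExactIsExactCubicFormDicksonExact

/-!
# Crux `CubicForrelation.NearExactIsExact` (stmt-QuantumAdvantage-14043) — the LIGHT CELL: a hyperplane-supported cubic carries a maximal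
  symplectic frame inside the hyperplane, with a radical dual vector, and its weight PINS the rank (`#ρ = 2^{n−2} − 2^{n−2−h}`)

Certificate seat `b2b-cforr-cert` (gen 41).  HONEST FRAMING: kernel-checked assembly (standard axioms) of the tree's `kt3_hyperplane_form`
(…KtThreeForm), …CubicFormSymplectic (`tcs_frame_exists`), …CubicFormRadical (`tce_radical_card`) and …CubicFormDicksonExact
(`tce_dickson_exact`): step (4) "K–T on the light cell" of the Lean roadmap for `E1280-even` (HOME/b2b-cforr-cert-g40/LEAN-PLAN-E1280-EVEN.md
§2 (f), §4), in the exact format consumed by …CubicFormFrameK `tcg_adapted_frame_le` (forms `z, B(·,cᵢ), B(·,bᵢ)` via …CubicFormSymplecticCoords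
`tsc_additive_parity`, dual family `v, bᵢ, cᵢ`) and by …CubicFormHyperplane `tch_third_of_hyperplane` (`t̄ = z ∧ B`).  On `9` bits:
`#ρ = 64, 96, 112, 120 ↔ h = 1, 2, 3, 4`, i.e. the descendants `T, s₀ω₄, s₀ω₆, s₀ω₈`.  Nothing about `θ₁₂`; NOT summit progress.

* `tlc_light_frame`: for `deg ρ ≤ 3` with `supp ρ ⊆ {⟨x,z⟩ = b}` (`z ≠ 0`) there are `v` (`⟨v,z⟩ = 1`), `h`, and a frame `(bᵢ, cᵢ)_{i<h}`
  such that, with `q = ρ ⊕ ρ(·⊕v)` (degree `≤ 2`, `ρ = [⟨x,z⟩ = b]·q`) and `B` its base-point free second-difference form: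
  the frame is symplectic and MAXIMAL for `B`, lies in `ker z`, `v` is `B`-radical (so `v, bᵢ, cᵢ` is dual to `z, B(·,cᵢ), B(·,bᵢ)`),
  `2h ≤ n`, and `4·#ρ + 2^{n−h} = 2ⁿ ∨ 4·#ρ = 2ⁿ ∨ 4·#ρ = 2ⁿ + 2^{n−h}`.

References: T. Kasami, N. Tokura (1970) Thm 1; L. E. Dickson (1901); F. J. MacWilliams, N. J. A. Sloane (1977) Ch. 15 §2–3.
Axioms: the standard three.
-/

set_option linter.dupNamespace false -- D-0017: single-problem summit ⇒ `QuantumAdvantage.QuantumAdvantage` by design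

namespace Summit.QuantumAdvantage.QuantumAdvantage.Theorems.CubicForrelation.NearExactIsExact

open Finset
open Literature.Computability.QuantumComplexity
open Literature.Computability.QuantumComplexity.BuzetChailloux (bxor zeroVec bxor_comm bxor_self bxor_zeroVec zeroVec_bxor
  bxor_bxor_cancel_left)

variable {n : ℕ}

/-- **The light cell's frame.**  See the module docstring. [this work; cite: KasamiTokura1970, Thm 1] [cite: MacWilliamsSloane1977, Ch. 15 §2] -/
theorem tlc_light_frame (ρ : (Fin n → Bool) → Bool) (hρ : IsDegLeFun 3 ρ) (z : Fin n → Bool) (hz : z ≠ zeroVec) (bz : Bool)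
    (hsupp : ∀ x, ρ x = true → decide (Odd #(univ.filter fun i => (x i && z i) = true)) = bz) :
    ∃ (v : Fin n → Bool) (h : ℕ) (b c : Fin h → (Fin n → Bool)),
      let q : (Fin n → Bool) → Bool := fun x => ρ x ^^ ρ (bxor x v)
      let B : (Fin n → Bool) → (Fin n → Bool) → Bool :=
        fun u w => (q zeroVec ^^ q (bxor zeroVec w)) ^^ (q (bxor zeroVec u) ^^ q (bxor (bxor zeroVec u) w))
      decide (Odd #(univ.filter fun i => (v i && z i) = true)) = true ∧ IsDegLeFun 2 q ∧
      (∀ x, ρ x = (decide (decide (Odd #(univ.filter fun i => (x i && z i) = true)) = bz) && q x)) ∧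
      (∀ u w x, ((q x ^^ q (bxor x w)) ^^ (q (bxor x u) ^^ q (bxor (bxor x u) w))) = B u w) ∧
      (∀ i, B (b i) (c i) = true) ∧ (∀ i j, i ≠ j → B (b i) (c j) = false) ∧
      (∀ i j, B (b i) (b j) = false) ∧ (∀ i j, B (c i) (c j) = false) ∧
      (∀ x y, (∀ i, B x (b i) = false) → (∀ i, B x (c i) = false) → (∀ i, B y (b i) = false) → (∀ i, B y (c i) = false) →
        B x y = false) ∧
      (∀ i, decide (Odd #(univ.filter fun j => (b i j && z j) = true)) = false) ∧
      (∀ i, decide (Odd #(univ.filter fun j => (c i j && z j) = true)) = false) ∧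
      (∀ w, B v w = false) ∧
      2 * h ≤ n ∧
      (4 * #(univ.filter fun x : Fin n → Bool => ρ x = true) + 2 ^ (n - h) = 2 ^ n ∨
        4 * #(univ.filter fun x : Fin n → Bool => ρ x = true) = 2 ^ n ∨
        4 * #(univ.filter fun x : Fin n → Bool => ρ x = true) = 2 ^ n + 2 ^ (n - h)) := by
  classical
  obtain ⟨v, hvz, hq2, hper, hcard, hfac⟩ := kt3_hyperplane_form (d := 2) ρ hρ z hz bz hsupp
  set q : (Fin n → Bool) → Bool := fun x => ρ x ^^ ρ (bxor x v) with hq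
  set B : (Fin n → Bool) → (Fin n → Bool) → Bool :=
    fun u w => (q zeroVec ^^ q (bxor zeroVec w)) ^^ (q (bxor zeroVec u) ^^ q (bxor (bxor zeroVec u) w)) with hBdef
  -- base-point freeness (degree ≤ 2)
  have hB : ∀ u w x, ((q x ^^ q (bxor x w)) ^^ (q (bxor x u) ^^ q (bxor (bxor x u) w))) = B u w := by
    intro u w x
    have h1 : IsDegLeFun 1 (fun x => q x ^^ q (bxor x w)) := stub_derivDegree n 1 q w hq2
    obtain ⟨p, hp, hF⟩ := stub_derivDegree n 0 _ u h1
    have hpC : p = MvPolynomial.C (p.coeff 0) := MvPolynomial.totalDegree_eq_zero_iff_eq_C.mp (Nat.le_zero.mp hp)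
    have e1 := hF x
    have e2 := hF zeroVec
    rw [hpC, polyPhase_C] at e1 e2
    exact e1.trans e2.symm
  have hsymm : ∀ u w, B u w = B w u := by
    intro u w
    rw [← hB u w zeroVec, ← hB w u zeroVec, iw_bxor_assoc, iw_bxor_assoc, bxor_comm u w]
    cases q zeroVec <;> cases q (bxor zeroVec w) <;> cases q (bxor zeroVec u) <;> cases q (bxor zeroVec (bxor w u)) <;> rfl
  have halt : ∀ u, B u u = false := by
    intro u
    rw [← hB u u zeroVec, iw_bxor_assoc, bxor_self, bxor_zeroVec]
    cases q zeroVec <;> cases q (bxor zeroVec u) <;> rfl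
  have hadd : ∀ u u' w, B (bxor u u') w = (B u w ^^ B u' w) := by
    intro u u' w
    rw [← hB (bxor u u') w zeroVec, ← hB u w zeroVec, ← hB u' w u]
    simp only [zeroVec_bxor]
    cases q zeroVec <;> cases q w <;> cases q u <;> cases q (bxor u w) <;> cases q (bxor u u') <;>
      cases q (bxor (bxor u u') w) <;> rfl
  -- `v` is radical: `q` is `v`-periodic
  have hper' : ∀ x, q (bxor x v) = q x := fun x => hper x
  have hrad : ∀ w, B v w = false := by
    intro w
    rw [hsymm, ← hB w v zeroVec, hper' zeroVec, hper' (bxor zeroVec w)]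
    cases q zeroVec <;> cases q (bxor zeroVec w) <;> rfl
  -- a maximal frame, reduced into `ker z`
  obtain ⟨h, b₀, c₀, h1, h2, h3, h4, hmax⟩ := tcs_frame_exists B hsymm halt
  set P : (Fin n → Bool) → Bool := fun x => decide (Odd #(univ.filter fun i => (x i && z i) = true)) with hP
  have hPx : ∀ x y, P (bxor x y) = (P x ^^ P y) := fun x y => by rw [hP]; exact tow_parity_bxor x y z
  have hPv : P v = true := hvz
  set red : (Fin n → Bool) → (Fin n → Bool) := fun x => bxor x (fun j => P x && v j) with hred
  have hsm : ∀ (t : Bool) (w : Fin n → Bool), B (fun j => t && v j) w = false := by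
    intro t w; cases t
    · rw [tcf_smul_false]; have e := hadd w w w; rw [bxor_self] at e; rw [e]; cases B w w <;> rfl
    · rw [tcf_smul_true]; exact hrad w
  have hredB : ∀ x w, B (red x) w = B x w := by
    intro x w; rw [hred]; simp only; rw [hadd, hsm, Bool.xor_false]
  have hredB' : ∀ x w, B w (red x) = B w x := by
    intro x w; rw [hsymm, hredB, hsymm]
  have hredP : ∀ x, P (red x) = false := by
    intro x; rw [hred]; simp only; rw [hPx]
    have : P (fun j => P x && v j) = P x := by
      cases hx : P x
      · rw [tcf_smul_false]; rw [hP]; simp [zeroVec]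
      · rw [tcf_smul_true]; exact hPv
    rw [this, Bool.xor_self]
  set b : Fin h → (Fin n → Bool) := fun i => red (b₀ i) with hb
  set c : Fin h → (Fin n → Bool) := fun i => red (c₀ i) with hc
  have f1 : ∀ i, B (b i) (c i) = true := fun i => by rw [hb, hc]; simp only; rw [hredB, hredB']; exact h1 i
  have f2 : ∀ i j, i ≠ j → B (b i) (c j) = false := fun i j hij => by rw [hb, hc]; simp only; rw [hredB, hredB']; exact h2 i j hij
  have f3 : ∀ i j, B (b i) (b j) = false := fun i j => by rw [hb]; simp only; rw [hredB, hredB']; exact h3 i j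
  have f4 : ∀ i j, B (c i) (c j) = false := fun i j => by rw [hc]; simp only; rw [hredB, hredB']; exact h4 i j
  have fmax : ∀ x y, (∀ i, B x (b i) = false) → (∀ i, B x (c i) = false) → (∀ i, B y (b i) = false) →
      (∀ i, B y (c i) = false) → B x y = false := by
    intro x y hxb hxc hyb hyc
    refine hmax x y (fun i => ?_) (fun i => ?_) (fun i => ?_) (fun i => ?_)
    · have := hxb i; rw [hb] at this; simp only at this; rwa [hredB'] at this
    · have := hxc i; rw [hc] at this; simp only at this; rwa [hredB'] at this
    · have := hyb i; rw [hb] at this; simp only at this; rwa [hredB'] at this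
    · have := hyc i; rw [hc] at this; simp only at this; rwa [hredB'] at this
  -- Dickson, exact, for `q`; `#q = 2 #ρ`
  obtain ⟨-, hD⟩ := tce_dickson_exact q B hB h b c f1 f2 f3 fmax
  obtain ⟨hle, -⟩ := tce_radical_card B hsymm hadd h b c f1 f2 f3 fmax
  have hcard' : #(univ.filter fun x : Fin n → Bool => q x = true) = 2 * #(univ.filter fun x : Fin n → Bool => ρ x = true) := hcard
  refine ⟨v, h, b, c, hvz, hq2, hfac, hB, f1, f2, f3, f4, fmax, fun i => hredP _, fun i => hredP _, hrad, hle, ?_⟩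
  rw [hcard'] at hD
  omega

end Summit.QuantumAdvantage.QuantumAdvantage.Theorems.CubicForrelation.NearExactIsExact
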